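import Literature.NumberTheory.LFunctions.MoebiusCharSumLinnikBox
import Literature.NumberTheory.Sieve.SmoothNumbersLHalfAnalytic
import HarnessLib

/-!
# `TypeIILiouville` (crux stmt-Parity-13322, route `LiouvilleMAD`), line `Sketch` — Stub U2mu:
# twisted Möbius sums from a zero-free box of CONSTANT width (power saving)

Support file (`--supports stmt-Parity-13322`) for the negative line `Sketch` of the crux
`Summit.Parity.GeneralizedHardyLittlewood.Theses.LiouvilleMAD.TypeIILiouville`
(`TypeIILiouville → ∃ δ > 0, QuasiRiemannHypothesis (1 − δ)`).

**Theorem** (`stub_U2mu`).  For `0 < δ₀ ≤ 1/4` put `ε = δ₀/18`.  There are `C`, `N₀` such that for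
`N ≥ N₀`, every modulus `q ≤ N^ε`, every NON-PRINCIPAL character `χ` mod `q` whose `L(s, χ)` has no
zero with `1 − δ₀ ≤ Re s < 1`, `|Im s| ≤ N^ε + 1`:

`‖∑_{n ≤ N} χ(n) μ(n)‖ ≤ C · N^{1 − ε/2}`.

This is the tree's `MoebiusCharSumLinnikBox.norm_sum_le` (Iwaniec–Kowalski §18.2, Linnik's explicit
formula with a wide zero-free box) re-run with a box of CONSTANT width `η = δ₀` instead of
`K log L/L`: truncated Perron at `c = 1 + 1/log x'` (`x' = N + 1/2`), height `T = N^ε`, the contour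
moved to `Re s = 1 − δ₀/2` (`PerronShift.norm_sum_le`), and `1/L(s, χ)` controlled on the three edges
by the Borel–Carathéodory bounds of `MoebiusCharSumLinnikBoxBounds` (`norm_inv_left_le`,
`norm_inv_mul_rpow_le`, centre `1 + aδ₀ + it` with `a = 1/100`).  Bookkeeping: the left edge costs
`T · exp((4a+2)M) · x'^{1−δ₀/2}` with `M = 8 + (9/4)ε log N ≥ 2 + δ₀ log q + log(T+2) + log(log q + 5)`,
the horizontal edges `x'^{1 + aδ₀}/T`, the truncation `x' log x'/T`; with `ε = δ₀/18`, `a = 1/100`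
each is `≪ x' N^{−ε/2}`.
-/

noncomputable section

open Complex Filter Topology Finset
open scoped ArithmeticFunction.Moebius
open Literature.NumberTheory.LFunctions

namespace Summit.Parity.GeneralizedHardyLittlewood.Theorems.TypeIILiouville

/-- **Stub U2mu** (twisted Möbius sums from a zero-free box of constant width; Perron's formula
moved to `Re s = 1 − δ₀/2` at height `N^ε`, `ε = δ₀/18`, and Borel–Carathéodory bounds for `1/L` in
the zero-free discs). For `0 < δ₀ ≤ 1/4` there are `0 < ε ≤ δ₀`, `C`, `N₀` such that for `N ≥ N₀`,
`q ≤ N^ε`, `χ ≠ χ₀ mod q` with `L(z, χ) ≠ 0` on `1 − δ₀ ≤ Re z < 1`, `|Im z| ≤ N^ε + 1`: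
`‖∑_{n≤N} χ(n)μ(n)‖ ≤ C N^{1−ε/2}`. -/
theorem stub_U2mu : ∀ δ₀ : ℝ, 0 < δ₀ → δ₀ ≤ 1 / 4 → ∃ ε : ℝ, 0 < ε ∧ ε ≤ δ₀ ∧ ∃ C : ℝ, ∃ N₀ : ℕ,
    ∀ N : ℕ, N₀ ≤ N → ∀ (q : ℕ) [NeZero q], (q : ℝ) ≤ (N : ℝ) ^ ε →
      ∀ χ : DirichletCharacter ℂ q, χ ≠ 1 →
        (∀ z : ℂ, 1 - δ₀ ≤ z.re → z.re < 1 → |z.im| ≤ (N : ℝ) ^ ε + 1 → χ.LFunction z ≠ 0) →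
        ‖∑ n ∈ Icc 1 N, χ (n : ZMod q) * (ArithmeticFunction.moebius n : ℂ)‖ ≤
          C * (N : ℝ) ^ (1 - ε / 2) := by
  intro η hη0 hη4
  obtain ⟨K₀, hK₀0, hPerron⟩ := PerronShift.norm_sum_le
  -- the fixed parameters `a = 1/100`, `ε = η/18`, `Cc = log(2/(aη)) + π`, `ℓ₀`
  obtain ⟨a, ha⟩ : ∃ a : ℝ, a = 1 / 100 := ⟨_, rfl⟩
  have ha0 : 0 < a := by rw [ha]; norm_num
  have ha4 : a ≤ 1 / 4 := by rw [ha]; norm_num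
  obtain ⟨ε, hε⟩ : ∃ ε : ℝ, ε = η / 18 := ⟨_, rfl⟩
  have hε0 : 0 < ε := by rw [hε]; positivity
  have hεη : ε ≤ η := by rw [hε]; linarith
  have hηε : η = 18 * ε := by rw [hε]; ring
  obtain ⟨Cc, hCc⟩ : ∃ Cc : ℝ, Cc = Real.log (2 / (a * η)) + Real.pi := ⟨_, rfl⟩
  obtain ⟨ℓ₀, hℓ₀⟩ : ∃ ℓ₀ : ℝ, ℓ₀ = 100 / η + 10368 * K₀ / η ^ 2 + 2 := ⟨_, rfl⟩
  refine ⟨ε, hε0, hεη, 2 * (1 + 2 * Real.exp (17 + 4 * Cc) + 2 * Real.exp (4 * Cc + 1)),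
    ⌈Real.exp ℓ₀⌉₊, fun N hN q _ hq χ hχ hzf ↦ ?_⟩
  -- `ℓ = log N ≥ ℓ₀`
  have h100 : 0 ≤ 100 / η := by positivity
  have hK' : 0 ≤ 10368 * K₀ / η ^ 2 := by positivity
  have hℓ₀2 : 2 ≤ ℓ₀ := by rw [hℓ₀]; linarith
  have hNexp : Real.exp ℓ₀ ≤ N := (Nat.le_ceil _).trans (by exact_mod_cast hN)
  have hN0 : (0 : ℝ) < N := (Real.exp_pos _).trans_le hNexp
  obtain ⟨ℓ, hℓdef⟩ : ∃ ℓ : ℝ, ℓ = Real.log N := ⟨_, rfl⟩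
  have hℓℓ₀ : ℓ₀ ≤ ℓ := by
    rw [hℓdef, ← Real.log_exp ℓ₀]; exact Real.log_le_log (Real.exp_pos _) hNexp
  have hNℓ : (N : ℝ) = Real.exp ℓ := by rw [hℓdef, Real.exp_log hN0]
  have hℓ2 : 2 ≤ ℓ := hℓ₀2.trans hℓℓ₀
  have hℓη : 100 / η ≤ ℓ := by rw [hℓ₀] at hℓℓ₀; linarith
  have hηℓ : 100 ≤ η * ℓ := by
    have := mul_le_mul_of_nonneg_left hℓη hη0.le
    rwa [mul_div_cancel₀ _ hη0.ne'] at this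
  have hℓK : 10368 * K₀ / η ^ 2 ≤ ℓ := by rw [hℓ₀] at hℓℓ₀; linarith
  have hK₀ε : 32 * K₀ ≤ ε ^ 2 * ℓ := by
    have hη2 : 0 < η ^ 2 := by positivity
    have := mul_le_mul_of_nonneg_left hℓK hη2.le
    rw [mul_div_cancel₀ _ hη2.ne'] at this
    rw [hε, show (η / 18) ^ 2 * ℓ = η ^ 2 * ℓ / 324 by ring]
    linarith only [this]
  -- `N ≥ 3`, `x' = N + 1/2`, `c = 1 + 1/log x'`
  have hN3r : (3 : ℝ) ≤ N := by
    rw [hNℓ]; have := Real.add_one_le_exp ℓ; linarith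
  have hN3 : 3 ≤ N := by exact_mod_cast hN3r
  obtain ⟨x', hx'⟩ : ∃ x' : ℝ, x' = N + 1 / 2 := ⟨_, rfl⟩
  obtain ⟨c, hc⟩ : ∃ c : ℝ, c = 1 + 1 / Real.log x' := ⟨_, rfl⟩
  obtain ⟨hx'0, hlogx'1, hc1, hc2, _, _⟩ := halfInt_facts hN3 hx' hc
  have hlx1 : ℓ ≤ Real.log x' := by
    rw [hℓdef]; exact Real.log_le_log hN0 (by rw [hx']; linarith)
  have hlx2 : Real.log x' ≤ ℓ + 1 := by
    have h1 : x' ≤ 2 * N := by rw [hx']; linarith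
    have h2 := Real.log_le_log hx'0 h1
    rw [Real.log_mul (by norm_num) hN0.ne', ← hℓdef] at h2
    have := Real.log_two_lt_d9
    linarith
  have hlx0 : 0 < Real.log x' := by linarith
  -- `T = N^ε = e^{εℓ}`
  obtain ⟨T, hTdef⟩ : ∃ T : ℝ, T = (N : ℝ) ^ ε := ⟨_, rfl⟩
  have hTexp : T = Real.exp (ε * ℓ) := by
    rw [hTdef, Real.rpow_def_of_pos hN0, ← hℓdef, mul_comm]
  have hεℓ0 : 0 ≤ ε * ℓ := by positivity
  have hT1 : 1 ≤ T := by rw [hTexp]; have := Real.add_one_le_exp (ε * ℓ); linarith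
  have hT0 : 0 < T := by linarith
  -- the left abscissa
  obtain ⟨σ₀, hσ₀⟩ : ∃ σ₀ : ℝ, σ₀ = 1 - η / 2 := ⟨_, rfl⟩
  have hσ₀0 : 0 < σ₀ := by rw [hσ₀]; linarith
  have hσ₀1 : σ₀ ≤ 1 := by rw [hσ₀]; linarith
  have hσ₀2 : 1 / 2 ≤ σ₀ := by rw [hσ₀]; linarith
  have hσ₀c : σ₀ ≤ c := by linarith
  -- zero-freeness on the rectangle and on the discs
  have hrect : ∀ s ∈ Set.uIcc σ₀ c ×ℂ Set.uIcc (-T) T, χ.LFunction s ≠ 0 := by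
    intro s hs
    rw [mem_reProdIm, Set.uIcc_of_le hσ₀c, Set.uIcc_of_le (by linarith only [hT0]), Set.mem_Icc,
      Set.mem_Icc] at hs
    rcases lt_or_ge s.re 1 with h1 | h1
    · have h2 := hs.1.1
      rw [hσ₀] at h2
      refine hzf s (by linarith only [h2, hη0]) h1 ((abs_le.2 hs.2).trans ?_)
      rw [hTdef]; linarith only
    · exact DirichletCharacter.LFunction_ne_zero_of_one_le_re χ (Or.inl hχ) h1
  have hdisc : ∀ t : ℝ, |t| ≤ T → ∀ w : ℂ, ‖w - (1 + a * η + t * I)‖ < (1 + a) * η →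
      w.re < 1 → χ.LFunction w ≠ 0 := by
    intro t ht w hw hw1
    obtain ⟨hwre, -⟩ := InvLFunctionDisc.re_norm_of_mem_disc hη0 hη4 ha0 (by linarith) hw
    have hwim := MoebiusCharSumLinnikBox.abs_im_lt_of_mem_disc hw
    have hR : (1 + a) * η ≤ 1 := by rw [ha]; linarith only [hη4, hη0]
    refine hzf w (by linarith only [hwre]) hw1 ?_
    rw [← hTdef]; linarith only [hwim, ht, hR]
  -- the holomorphic `F = 1/L` on the rectangle and the Dirichlet series on `Re s = c`
  have hFd : DifferentiableOn ℂ (fun s ↦ (χ.LFunction s)⁻¹) (Set.uIcc σ₀ c ×ℂ Set.uIcc (-T) T) :=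
    ((DirichletCharacter.differentiable_LFunction hχ).differentiableOn.inv hrect)
  have hLF : ∀ t : ℝ, LSeries (fun n : ℕ ↦ χ (n : ZMod q) * (μ n : ℂ)) (c + t * I) =
      (fun s ↦ (χ.LFunction s)⁻¹) (c + t * I) :=
    fun t ↦ MoebiusTwist.LSeries_twist_moebius_eq_inv χ (by simpa using hc1)
  -- the majorant `M_t ≤ Mb = 8 + (9/4) ε ℓ`
  obtain ⟨Mb, hMb⟩ : ∃ Mb : ℝ, Mb = 8 + 9 / 4 * (ε * ℓ) := ⟨_, rfl⟩
  have hq1 : (1 : ℝ) ≤ q := by exact_mod_cast NeZero.one_le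
  have hlogq : Real.log q ≤ ε * ℓ := by
    calc Real.log q ≤ Real.log ((N : ℝ) ^ ε) := Real.log_le_log (by linarith) hq
      _ = ε * ℓ := by rw [Real.log_rpow hN0, ← hℓdef]
  have hlogq0 : 0 ≤ Real.log q := Real.log_nonneg hq1
  have hMt : ∀ t : ℝ, |t| ≤ T →
      2 + η * Real.log q + Real.log (|t| + 2) + Real.log (Real.log q + 5) ≤ Mb := by
    intro t ht
    have h1 : η * Real.log q ≤ ε * ℓ / 4 :=
      calc η * Real.log q ≤ η * (ε * ℓ) := mul_le_mul_of_nonneg_left hlogq hη0.le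
        _ ≤ 1 / 4 * (ε * ℓ) := mul_le_mul_of_nonneg_right hη4 hεℓ0
        _ = ε * ℓ / 4 := by ring
    have h2 : Real.log (|t| + 2) ≤ 2 + ε * ℓ := by
      have h4T : |t| + 2 ≤ 4 * T := by linarith only [ht, hT1]
      calc Real.log (|t| + 2) ≤ Real.log (4 * T) :=
            Real.log_le_log (by positivity) h4T
        _ = Real.log 4 + ε * ℓ := by rw [Real.log_mul (by norm_num) hT0.ne', hTexp, Real.log_exp]
        _ ≤ 2 + ε * ℓ := by
            have hl4 : Real.log 4 ≤ 2 := by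
              rw [Real.log_le_iff_le_exp (by norm_num)]
              have := Real.quadratic_le_exp_of_nonneg (by norm_num : (0 : ℝ) ≤ 2)
              linarith only [this]
            linarith only [hl4]
    have h3 : Real.log (Real.log q + 5) ≤ Real.log q + 4 := by
      rw [Real.log_le_iff_le_exp (by linarith)]
      have := Real.add_one_le_exp (Real.log q + 4)
      linarith only [this]
    rw [hMb]; linarith only [h1, h2, h3, hlogq]
  -- `4 Mb/η ≤ log x'` and `c ≤ 1 + aη`
  have hlog4M : 4 * Mb / η ≤ Real.log x' := by
    rw [div_le_iff₀ hη0, hMb]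
    have e1 : 4 * (8 + 9 / 4 * (ε * ℓ)) = 32 + η * ℓ / 2 := by rw [hηε]; ring
    rw [e1]
    have h1 := mul_le_mul_of_nonneg_left hlx1 hη0.le
    have h2 : Real.log x' * η = η * Real.log x' := mul_comm _ _
    rw [h2]
    linarith only [h1, hηℓ]
  have hcaη : c ≤ 1 + a * η := by
    rw [hc, ha]
    have h1 : 1 / Real.log x' ≤ 1 / 100 * η := by
      rw [div_le_iff₀ hlx0]
      have h2 := mul_le_mul_of_nonneg_left hlx1 hη0.le
      calc (1 : ℝ) = 1 / 100 * 100 := by norm_num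
        _ ≤ 1 / 100 * (η * Real.log x') := by linarith only [h2, hηℓ]
        _ = 1 / 100 * η * Real.log x' := by ring
    linarith only [h1]
  -- the majorants `V` (left edge) and `W` (horizontal edges)
  obtain ⟨V, hV⟩ : ∃ V : ℝ, V = Real.exp ((4 * a + 2) * Mb + 4 * Cc) := ⟨_, rfl⟩
  obtain ⟨W, hW⟩ : ∃ W : ℝ, W = x' * Real.exp (a * η * Real.log x' + 4 * Cc) := ⟨_, rfl⟩
  have hCc' : Real.log (2 / (a * η)) + Real.pi ≤ Cc := le_of_eq hCc.symm
  have hVb : ∀ t : ℝ, |t| ≤ T → ‖(fun s ↦ (χ.LFunction s)⁻¹) (σ₀ + t * I)‖ ≤ V := by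
    intro t ht
    have h := MoebiusCharSumLinnikBox.norm_inv_left_le χ hχ hη0 hη4 ha0 ha4 (hdisc t ht) (hMt t ht)
      hCc'
    rw [← hσ₀] at h
    rw [hV]; exact h
  have hWb : ∀ t : ℝ, |t| ≤ T → ∀ σ : ℝ, σ₀ ≤ σ → σ ≤ c →
      ‖(fun s ↦ (χ.LFunction s)⁻¹) (σ + t * I)‖ * x' ^ σ ≤ W := by
    intro t ht σ h1 h2
    rw [hW]
    exact MoebiusCharSumLinnikBox.norm_inv_mul_rpow_le χ hχ hη0 hη4 ha0 ha4 (hdisc t ht) (hMt t ht)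
      hCc' hx'0 hlog4M (by rw [hσ₀] at h1; exact h1) (h2.trans hcaη)
  -- Perron with the contour moved to `Re s = σ₀`
  have main := hPerron _ (MoebiusCharSumLinnikBox.norm_twist_moebius_le χ) N hN3 x' c hx' hc T σ₀
    hT1 hσ₀0 hσ₀1 _ hFd hLF V W hVb (hWb T (abs_of_pos hT0).le) (fun σ h1 h2 ↦ by
      have := hWb (-T) (by rw [abs_neg, abs_of_pos hT0]) σ h1 h2; push_cast at this; exact this)
  -- the three pieces are `≪ x' e^{-εℓ/2}`
  obtain ⟨E, hE⟩ : ∃ E : ℝ, E = Real.exp (-(ε * ℓ / 2)) := ⟨_, rfl⟩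
  have hE0 : 0 < E := by rw [hE]; exact Real.exp_pos _
  have hET : E * T = Real.exp (ε * ℓ / 2) := by
    rw [hE, hTexp, ← Real.exp_add]; ring_nf
  -- piece 1: the truncation term
  have hP1 : K₀ * x' * Real.log x' / T ≤ x' * E := by
    rw [div_le_iff₀ hT0, mul_assoc x' E T, hET]
    have h1 : Real.log x' ≤ 2 * ℓ := by linarith only [hlx2, hℓ2]
    have h2 : 2 * K₀ * ℓ ≤ ε ^ 2 * ℓ ^ 2 / 16 :=
      calc 2 * K₀ * ℓ = 32 * K₀ * (ℓ / 16) := by ring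
        _ ≤ ε ^ 2 * ℓ * (ℓ / 16) := mul_le_mul_of_nonneg_right hK₀ε (by positivity)
        _ = ε ^ 2 * ℓ ^ 2 / 16 := by ring
    have h3 : ε ^ 2 * ℓ ^ 2 / 16 ≤ Real.exp (ε * ℓ / 2) := by
      have := Literature.NumberTheory.Sieve.LHalf.sq_div_le_exp_half hεℓ0
      rw [mul_pow] at this; exact this
    calc K₀ * x' * Real.log x' ≤ K₀ * x' * (2 * ℓ) :=
          mul_le_mul_of_nonneg_left h1 (by positivity)
      _ = x' * (2 * K₀ * ℓ) := by ring
      _ ≤ x' * Real.exp (ε * ℓ / 2) := mul_le_mul_of_nonneg_left (h2.trans h3) hx'0.le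
  -- piece 2: the left edge
  have hP2 : T * V * x' ^ σ₀ / σ₀ ≤ 2 * Real.exp (17 + 4 * Cc) * (x' * E) := by
    have hxσ : x' ^ σ₀ ≤ x' * Real.exp (-(η / 2 * ℓ)) := by
      rw [Real.rpow_def_of_pos hx'0, hσ₀,
        show Real.log x' * (1 - η / 2) = Real.log x' + -(η / 2 * Real.log x') by ring,
        Real.exp_add, Real.exp_log hx'0]
      refine mul_le_mul_of_nonneg_left (Real.exp_le_exp.2 ?_) hx'0.le
      have := mul_le_mul_of_nonneg_left hlx1 (by positivity : (0 : ℝ) ≤ η / 2)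
      linarith only [this]
    have hTV0 : 0 ≤ T * V := by rw [hV]; positivity
    have h2 : T * V * x' ^ σ₀ / σ₀ ≤ 2 * (T * V * (x' * Real.exp (-(η / 2 * ℓ)))) := by
      rw [div_le_iff₀ hσ₀0]
      have h3 : T * V * x' ^ σ₀ ≤ T * V * (x' * Real.exp (-(η / 2 * ℓ))) :=
        mul_le_mul_of_nonneg_left hxσ hTV0
      have h4 : 0 ≤ T * V * (x' * Real.exp (-(η / 2 * ℓ))) := by positivity
      nlinarith only [h3, h4, hσ₀2]
    refine h2.trans ?_
    have e1 : T * V * (x' * Real.exp (-(η / 2 * ℓ))) =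
        x' * Real.exp (ε * ℓ + ((4 * a + 2) * Mb + 4 * Cc) + -(η / 2 * ℓ)) := by
      rw [Real.exp_add, Real.exp_add, hTexp, hV]; ring
    have e2 : 2 * Real.exp (17 + 4 * Cc) * (x' * E) =
        2 * (x' * Real.exp (17 + 4 * Cc + -(ε * ℓ / 2))) := by
      rw [Real.exp_add (17 + 4 * Cc) (-(ε * ℓ / 2)), hE]; ring
    rw [e1, e2]
    refine mul_le_mul_of_nonneg_left (mul_le_mul_of_nonneg_left (Real.exp_le_exp.2 ?_) hx'0.le)
      (by norm_num)
    rw [hMb, ha, hηε]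
    nlinarith only [hεℓ0]
  -- piece 3: the horizontal edges
  have hP3 : (c - σ₀) * W / T ≤ 2 * Real.exp (4 * Cc + 1) * (x' * E) := by
    have hcσ : c - σ₀ ≤ 2 := by rw [hσ₀]; linarith only [hc2, hη4]
    have hcσ0 : 0 ≤ c - σ₀ := by linarith only [hσ₀c]
    have hWT : W / T = x' * Real.exp (a * η * Real.log x' + 4 * Cc + -(ε * ℓ)) := by
      rw [hW, hTexp, Real.exp_add _ (-(ε * ℓ)), Real.exp_neg]; ring
    have hWT0 : 0 ≤ W / T := by rw [hWT]; positivity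
    have h1 : W / T ≤ x' * Real.exp (4 * Cc + 1 + -(ε * ℓ / 2)) := by
      rw [hWT]
      refine mul_le_mul_of_nonneg_left (Real.exp_le_exp.2 ?_) hx'0.le
      have h2 : a * η * Real.log x' ≤ a * η * (ℓ + 1) :=
        mul_le_mul_of_nonneg_left hlx2 (by positivity)
      rw [ha, hηε] at h2 ⊢
      have hε1 : ε ≤ 1 := by linarith only [hεη, hη4]
      nlinarith only [h2, hεℓ0, hε1, hε0]
    calc (c - σ₀) * W / T = (c - σ₀) * (W / T) := by ring
      _ ≤ 2 * (x' * Real.exp (4 * Cc + 1 + -(ε * ℓ / 2))) :=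
          mul_le_mul hcσ h1 hWT0 (by norm_num)
      _ = 2 * Real.exp (4 * Cc + 1) * (x' * E) := by
          rw [Real.exp_add (4 * Cc + 1) (-(ε * ℓ / 2)), hE]; ring
  -- assembly
  have hx'N : x' ≤ 2 * N := by rw [hx']; linarith only [hN3r]
  have hNpow : (N : ℝ) ^ (1 - ε / 2) = N * E := by
    rw [Real.rpow_def_of_pos hN0, ← hℓdef, show ℓ * (1 - ε / 2) = ℓ + -(ε * ℓ / 2) by ring,
      Real.exp_add, ← hNℓ, hE]
  have hC0 : 0 ≤ 1 + 2 * Real.exp (17 + 4 * Cc) + 2 * Real.exp (4 * Cc + 1) := by positivity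
  calc ‖∑ n ∈ Icc 1 N, χ (n : ZMod q) * (ArithmeticFunction.moebius n : ℂ)‖
      ≤ K₀ * x' * Real.log x' / T + T * V * x' ^ σ₀ / σ₀ + (c - σ₀) * W / T := main
    _ ≤ x' * E + 2 * Real.exp (17 + 4 * Cc) * (x' * E) + 2 * Real.exp (4 * Cc + 1) * (x' * E) := by
        linarith only [hP1, hP2, hP3]
    _ = (1 + 2 * Real.exp (17 + 4 * Cc) + 2 * Real.exp (4 * Cc + 1)) * (x' * E) := by ring
    _ ≤ (1 + 2 * Real.exp (17 + 4 * Cc) + 2 * Real.exp (4 * Cc + 1)) * (2 * N * E) := by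
        refine mul_le_mul_of_nonneg_left ?_ hC0
        exact mul_le_mul_of_nonneg_right hx'N hE0.le
    _ = 2 * (1 + 2 * Real.exp (17 + 4 * Cc) + 2 * Real.exp (4 * Cc + 1)) * (N : ℝ) ^ (1 - ε / 2) := by
        rw [hNpow]; ring

end Summit.Parity.GeneralizedHardyLittlewood.Theorems.TypeIILiouville

end
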